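import Mathlib

/-! # (G3) WIDE VOID ⇒ LANDING — three real critical points from a weak field at the pair
(W-08 cell C3 «analysis», rh-idea-3 g38; director (CA375)(R2)/(S2); bus RESULT-4.) Mathlib only.

Real-variable lemma. `g = f^{(k)}` on the real axis, zero-free on the void `(xL, xR)` with teeth `g xL = g xR = 0`, the low pair
at `a ± ib` with `xL < a − b < a + b < xR`. HYPOTHESES `h1 : g′(a − b)·g(a − b) < 0` (|g| decreasing at `a − b`) and
`h2 : 0 < g′(a + b)·g(a + b)` (|g| increasing at `a + b`) — both follow from a WEAK cofactor field `|K(a ∓ b)| < 1/b`, since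
`g′/g = K + 2(x − a)/((x − a)² + b²)` and the pair term equals `∓ 1/b` at `a ∓ b`. CONCLUSION: `g′` vanishes in EACH of
`(xL, a − b)`, `(a − b, a + b)`, `(a + b, xR)` — three real critical points in the void; by the critical-point count (one per
aloft level) the pair has LANDED, the central zero being the NL event at distance `< b` from `Re v`.
Tools: MVT (`exists_hasDerivAt_eq_slope`) + IVT. Nothing here bears on the truth of RH. -/

namespace RhIdea3.G38.WideVoid

open Set

/-- IVT with a strict sign change gives an INTERIOR zero. -/
theorem exists_zero_Ioo_of_mul_neg {φ : ℝ → ℝ} {p q : ℝ} (hpq : p ≤ q) (hφ : ContinuousOn φ (Icc p q))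
    (h : φ p * φ q < 0) : ∃ c ∈ Ioo p q, φ c = 0 := by
  have hp0 : φ p ≠ 0 := fun h0 => by rw [h0, zero_mul] at h; exact lt_irrefl 0 h
  have hq0 : φ q ≠ 0 := fun h0 => by rw [h0, mul_zero] at h; exact lt_irrefl 0 h
  have key : ∃ c ∈ Icc p q, φ c = 0 := by
    rcases mul_neg_iff.mp h with ⟨hp, hq⟩ | ⟨hp, hq⟩
    · have hmem : (0 : ℝ) ∈ Icc (φ q) (φ p) := ⟨hq.le, hp.le⟩
      obtain ⟨c, hc, hc0⟩ := intermediate_value_Icc' hpq hφ hmem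
      exact ⟨c, hc, hc0⟩
    · have hmem : (0 : ℝ) ∈ Icc (φ p) (φ q) := ⟨hp.le, hq.le⟩
      obtain ⟨c, hc, hc0⟩ := intermediate_value_Icc hpq hφ hmem
      exact ⟨c, hc, hc0⟩
  obtain ⟨c, ⟨hpc, hcq⟩, hc0⟩ := key
  have hcp : c ≠ p := fun e => hp0 (e ▸ hc0)
  have hcq' : c ≠ q := fun e => hq0 (e ▸ hc0)
  exact ⟨c, ⟨lt_of_le_of_ne hpc (Ne.symm hcp), lt_of_le_of_ne hcq hcq'⟩, hc0⟩

/-- (G3) WIDE VOID ⇒ THREE REAL CRITICAL POINTS (⇒ landing). -/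
theorem three_crit_of_weak_field {g g' : ℝ → ℝ} {xL xR a b : ℝ}
    (hg : ∀ x ∈ Icc xL xR, HasDerivAt g (g' x) x) (hg' : ContinuousOn g' (Icc xL xR))
    (h0 : ∀ x ∈ Ioo xL xR, g x ≠ 0) (hL : g xL = 0) (hR : g xR = 0)
    (hxa : xL < a - b) (hab : a - b < a + b) (hxb : a + b < xR)
    (h1 : g' (a - b) * g (a - b) < 0) (h2 : 0 < g' (a + b) * g (a + b)) :
    (∃ x₁ ∈ Ioo xL (a - b), g' x₁ = 0) ∧ (∃ x₀ ∈ Ioo (a - b) (a + b), g' x₀ = 0) ∧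
      (∃ x₂ ∈ Ioo (a + b) xR, g' x₂ = 0) := by
  have hcont : ContinuousOn g (Icc xL xR) := fun x hx => (hg x hx).continuousAt.continuousWithinAt
  have hga : g (a - b) ≠ 0 := h0 _ ⟨hxa, by linarith⟩
  have hgb : g (a + b) ≠ 0 := h0 _ ⟨by linarith, hxb⟩
  refine ⟨?_, ?_, ?_⟩
  · -- left: MVT on [xL, a-b] gives ξ with g' ξ · g(a-b) > 0, then IVT on [ξ, a-b]
    obtain ⟨ξ, ⟨hξ1, hξ2⟩, hξ⟩ := exists_hasDerivAt_eq_slope g g' hxa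
      (hcont.mono (Icc_subset_Icc le_rfl (by linarith)))
      (fun x hx => hg x ⟨hx.1.le, by linarith [hx.2]⟩)
    rw [hL, sub_zero] at hξ
    have hA : 0 < g' ξ * g (a - b) := by
      rw [hξ, div_mul_eq_mul_div]
      exact div_pos (mul_self_pos.mpr hga) (by linarith)
    have hprod : g' ξ * g' (a - b) < 0 := by
      by_contra hc
      push Not at hc
      have e : (g' ξ * g (a - b)) * (g' (a - b) * g (a - b)) = (g' ξ * g' (a - b)) * g (a - b) ^ 2 := by ring
      have hAB : (g' ξ * g (a - b)) * (g' (a - b) * g (a - b)) < 0 := mul_neg_of_pos_of_neg hA h1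
      rw [e] at hAB
      have := mul_nonneg hc (sq_nonneg (g (a - b)))
      linarith
    obtain ⟨c, ⟨hc1, hc2⟩, hc0⟩ := exists_zero_Ioo_of_mul_neg hξ2.le
      (hg'.mono (Icc_subset_Icc hξ1.le (by linarith))) hprod
    exact ⟨c, ⟨lt_trans hξ1 hc1, hc2⟩, hc0⟩
  · -- middle: g(a-b), g(a+b) have the same sign (no zero between), so g' changes sign
    have hsame : 0 < g (a - b) * g (a + b) := by
      rcases lt_or_gt_of_ne (mul_ne_zero hga hgb) with hneg | hpos
      · exfalso
        obtain ⟨c, ⟨hc1, hc2⟩, hc0⟩ := exists_zero_Ioo_of_mul_neg hab.le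
          (hcont.mono (Icc_subset_Icc hxa.le hxb.le)) hneg
        exact h0 c ⟨lt_trans hxa hc1, lt_trans hc2 hxb⟩ hc0
      · exact hpos
    have hprod : g' (a - b) * g' (a + b) < 0 := by
      by_contra hc
      push Not at hc
      have e : (g' (a - b) * g (a - b)) * (g' (a + b) * g (a + b)) =
          (g' (a - b) * g' (a + b)) * (g (a - b) * g (a + b)) := by ring
      have hAB : (g' (a - b) * g (a - b)) * (g' (a + b) * g (a + b)) < 0 := mul_neg_of_neg_of_pos h1 h2
      rw [e] at hAB
      have := mul_nonneg hc hsame.le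
      linarith
    exact exists_zero_Ioo_of_mul_neg hab.le (hg'.mono (Icc_subset_Icc hxa.le hxb.le)) hprod
  · -- right: MVT on [a+b, xR] gives ξ with g' ξ · g(a+b) < 0, then IVT on [a+b, ξ]
    obtain ⟨ξ, ⟨hξ1, hξ2⟩, hξ⟩ := exists_hasDerivAt_eq_slope g g' hxb
      (hcont.mono (Icc_subset_Icc (by linarith) le_rfl))
      (fun x hx => hg x ⟨by linarith [hx.1], hx.2.le⟩)
    rw [hR, zero_sub] at hξ
    have hA : g' ξ * g (a + b) < 0 := by
      rw [hξ, div_mul_eq_mul_div]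
      apply div_neg_of_neg_of_pos _ (by linarith)
      have : 0 < g (a + b) * g (a + b) := mul_self_pos.mpr hgb
      linarith [this]
    have hprod : g' (a + b) * g' ξ < 0 := by
      by_contra hc
      push Not at hc
      have e : (g' (a + b) * g (a + b)) * (g' ξ * g (a + b)) = (g' (a + b) * g' ξ) * g (a + b) ^ 2 := by ring
      have hAB : (g' (a + b) * g (a + b)) * (g' ξ * g (a + b)) < 0 := mul_neg_of_pos_of_neg h2 hA
      rw [e] at hAB
      have := mul_nonneg hc (sq_nonneg (g (a + b)))
      linarith
    obtain ⟨c, ⟨hc1, hc2⟩, hc0⟩ := exists_zero_Ioo_of_mul_neg hξ1.le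
      (hg'.mono (Icc_subset_Icc (by linarith) hξ2.le)) hprod
    exact ⟨c, ⟨hc1, lt_trans hc2 hξ2⟩, hc0⟩

/-- The field form of `h1`/`h2`: if `g′ x = g x · (K + P)` (log-derivative = cofactor field + pair term) with the pair term
`P = ∓ 1/b` at `a ∓ b` and `|K| < 1/b`, the signs are as required. Stated pointwise over reals. -/
theorem sign_of_weak_field {gx g'x K b : ℝ} (hgx : gx ≠ 0) (hK : |K| < 1 / b) :
    (g'x = gx * (K - 1 / b) → g'x * gx < 0) ∧ (g'x = gx * (K + 1 / b) → 0 < g'x * gx) := by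
  have hg2 : 0 < gx * gx := mul_self_pos.mpr hgx
  have hK1 : K - 1 / b < 0 := by linarith [le_abs_self K]
  have hK2 : 0 < K + 1 / b := by linarith [neg_abs_le K]
  constructor
  · intro h; rw [h]
    have : gx * (K - 1 / b) * gx = (K - 1 / b) * (gx * gx) := by ring
    rw [this]; exact mul_neg_of_neg_of_pos hK1 hg2
  · intro h; rw [h]
    have : gx * (K + 1 / b) * gx = (K + 1 / b) * (gx * gx) := by ring
    rw [this]; exact mul_pos hK2 hg2

/-- The pair term of the log-derivative at `a ∓ b` is `∓ 1/b`. -/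
theorem pair_term_at (a b : ℝ) (hb : b ≠ 0) :
    2 * ((a - b) - a) / (((a - b) - a) ^ 2 + b ^ 2) = -(1 / b) ∧
      2 * ((a + b) - a) / (((a + b) - a) ^ 2 + b ^ 2) = 1 / b := by
  constructor
  · field_simp; ring
  · field_simp; ring

end RhIdea3.G38.WideVoid
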